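import Mathlib
import Summits.Parity.GeneralizedHardyLittlewood.Theses.LiouvilleMAD
import Summits.Parity.GeneralizedHardyLittlewood.Theorems.LiouvilleMADCosetDecorrelationStubNormalForm

/-!
# The fluctuation stub of line `Sketch` IS the mean-corrected crux (residual K1 of line `SketchIdeator3`)

Stub `stub_fluctMode_iff_meanCorrected` of line `Sketch` (card `gram-split-farey-phase`, ideator 2)
of crux stmt-Parity-13317 (`Summit.Parity.GeneralizedHardyLittlewood.Theses.LiouvilleMAD.CosetDecorrelation`).
The line files the hypothesis `FluctMode`: the mean-free class profiles of `λ` along the two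
progressions decorrelate,
`|Σ_{a<j} (A_n(a) − S(n)/j)(A_{n'}(a) − S(n')/j)| ≤ C·M^{3/4+ϑ}`, `A_n(a) = Σ_{m∈(M,2M], m % j = a} λ(mn+c)`,
`S(n) = Σ_{m∈(M,2M]} λ(mn+c)`, on the crux's ranges.  By the mean-coupling identity (landed
`stub_normalForm`, p96729, line `SketchIdeator3`) the summed quantity equals `T_j − S(n)S(n')/j`
(coset sum minus its level-1 term) on the nose, so the `FluctMode` family is, statement for
statement, the residual K1 `MeanCorrectedCosetDecorrelation` of line `SketchIdeator3`: the two lines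
cut the crux at the same seam. [folklore]

**What is proved.**
* `fluct_filter_mod_eq` : for `a < j` the class `{m % j = a}` is the class `{m ≡ a (mod j)}`;
* `fluct_eq_meanCorrected` : the identity above for general real weights (from `stub_normalForm`);
* `stub_fluctMode_iff_meanCorrected` (REGISTERED periphery stub of line `Sketch`): the two families of
  bounds are equivalent (same `ϑ`, same `C`, instance by instance).
-/

namespace Summit.Parity.GeneralizedHardyLittlewood.Theorems.CosetDecorrelation.GramSplitFareyPhase

open Finset

/-- For `a < j`, the residue class cut out by `m % j = a` is the class `m ≡ a (mod j)`. -/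
theorem fluct_filter_mod_eq (s : Finset ℕ) {j a : ℕ} (ha : a < j) :
    s.filter (fun m => m % j = a) = s.filter (fun m => m ≡ a [MOD j]) := by
  refine Finset.filter_congr fun m _ => ?_
  rw [Nat.ModEq, Nat.mod_eq_of_lt ha]

/-- MEAN COUPLING in ideator 2's spelling (general real weights, `j ≥ 1`): the inner product of the
mean-free class profiles (classes `m % j = a`, `a < j`) equals the coset sum minus its level-1 term
`(Σf)(Σg)/j`.  (`stub_normalForm` of p96729 with the classes re-spelled by `fluct_filter_mod_eq`.) -/
theorem fluct_eq_meanCorrected (f g : ℕ → ℝ) (M j : ℕ) (hj : 1 ≤ j) :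
    ∑ a ∈ Finset.range j,
        ((∑ m ∈ (Finset.Ioc M (2 * M)).filter (fun m => m % j = a), f m)
            - (∑ m ∈ Finset.Ioc M (2 * M), f m) / (j : ℝ)) *
          ((∑ m ∈ (Finset.Ioc M (2 * M)).filter (fun m => m % j = a), g m)
            - (∑ m ∈ Finset.Ioc M (2 * M), g m) / (j : ℝ))
      = (∑ p ∈ (Finset.Ioc M (2 * M) ×ˢ Finset.Ioc M (2 * M)).filter
            (fun p : ℕ × ℕ => p.1 ≡ p.2 [MOD j]), f p.1 * g p.2)
        - (∑ m ∈ Finset.Ioc M (2 * M), f m) * (∑ m ∈ Finset.Ioc M (2 * M), g m) / (j : ℝ) := by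
  rw [FareyLevelMeanCoupling.stub_normalForm f g M j hj]
  refine Finset.sum_congr rfl fun a ha => ?_
  rw [fluct_filter_mod_eq _ (Finset.mem_range.mp ha)]

/-- **STUB `stub_fluctMode_iff_meanCorrected`** (registered periphery stub of line `Sketch`, crux
stmt-Parity-13317): the fluctuation hypothesis family of line `Sketch` (ideator 2's `FluctMode c ϑ`
for every `c ≠ 0` with some `ϑ < 1/4`, classes spelled `m % j = a`) is EQUIVALENT to the
mean-corrected coset decorrelation K1 (`MeanCorrectedCosetDecorrelation`, the registered residual
`stub_meanCorrectedCosetDecorrelation` of line `SketchIdeator3`) — instance by instance, with the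
same `ϑ` and `C`. -/
theorem stub_fluctMode_iff_meanCorrected :
    (∀ c : ℤ, c ≠ 0 → ∃ ϑ : ℝ, ϑ < 1 / 4 ∧ ∃ C : ℝ, ∀ M n n' j : ℕ, 1 ≤ n → 1 ≤ n' → n ≠ n' →
      n ≤ 2 * M → n' ≤ 2 * M → Nat.sqrt M + 1 ≤ j → j < 2 * (Nat.sqrt M + 1) →
        |∑ a ∈ Finset.range j,
            ((∑ m ∈ (Finset.Ioc M (2 * M)).filter (fun m => m % j = a),
                (ArithmeticFunction.liouville (Int.toNat ((m : ℤ) * n + c)) : ℝ))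
              - (∑ m ∈ Finset.Ioc M (2 * M),
                  (ArithmeticFunction.liouville (Int.toNat ((m : ℤ) * n + c)) : ℝ)) / (j : ℝ)) *
            ((∑ m ∈ (Finset.Ioc M (2 * M)).filter (fun m => m % j = a),
                (ArithmeticFunction.liouville (Int.toNat ((m : ℤ) * n' + c)) : ℝ))
              - (∑ m ∈ Finset.Ioc M (2 * M),
                  (ArithmeticFunction.liouville (Int.toNat ((m : ℤ) * n' + c)) : ℝ)) / (j : ℝ))|
          ≤ C * (M : ℝ) ^ (3 / 4 + ϑ)) ↔
    (∀ c : ℤ, c ≠ 0 → ∃ ϑ : ℝ, ϑ < 1 / 4 ∧ ∃ C : ℝ, ∀ M n n' j : ℕ, 1 ≤ n → 1 ≤ n' → n ≠ n' →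
      n ≤ 2 * M → n' ≤ 2 * M → Nat.sqrt M + 1 ≤ j → j < 2 * (Nat.sqrt M + 1) →
        |(∑ p ∈ (Finset.Ioc M (2 * M) ×ˢ Finset.Ioc M (2 * M)).filter
              (fun p : ℕ × ℕ => p.1 ≡ p.2 [MOD j]),
            (ArithmeticFunction.liouville (Int.toNat ((p.1 : ℤ) * n + c)) : ℝ) *
              (ArithmeticFunction.liouville (Int.toNat ((p.2 : ℤ) * n' + c)) : ℝ))
          - (∑ m ∈ Finset.Ioc M (2 * M), (ArithmeticFunction.liouville (Int.toNat ((m : ℤ) * n + c)) : ℝ)) *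
              (∑ m ∈ Finset.Ioc M (2 * M), (ArithmeticFunction.liouville (Int.toNat ((m : ℤ) * n' + c)) : ℝ)) /
                (j : ℝ)|
          ≤ C * (M : ℝ) ^ (3 / 4 + ϑ)) := by
  constructor
  · intro h c hc
    obtain ⟨ϑ, hϑ, C, hC⟩ := h c hc
    refine ⟨ϑ, hϑ, C, fun M n n' j hn hn' hne hnM hn'M hj1 hj2 => ?_⟩
    have hj : 1 ≤ j := le_trans (Nat.succ_le_succ (Nat.zero_le _)) hj1
    have e := fluct_eq_meanCorrected
      (fun m => (ArithmeticFunction.liouville (Int.toNat ((m : ℤ) * n + c)) : ℝ))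
      (fun m => (ArithmeticFunction.liouville (Int.toNat ((m : ℤ) * n' + c)) : ℝ)) M j hj
    rw [← e]
    exact hC M n n' j hn hn' hne hnM hn'M hj1 hj2
  · intro h c hc
    obtain ⟨ϑ, hϑ, C, hC⟩ := h c hc
    refine ⟨ϑ, hϑ, C, fun M n n' j hn hn' hne hnM hn'M hj1 hj2 => ?_⟩
    have hj : 1 ≤ j := le_trans (Nat.succ_le_succ (Nat.zero_le _)) hj1
    have e := fluct_eq_meanCorrected
      (fun m => (ArithmeticFunction.liouville (Int.toNat ((m : ℤ) * n + c)) : ℝ))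
      (fun m => (ArithmeticFunction.liouville (Int.toNat ((m : ℤ) * n' + c)) : ℝ)) M j hj
    rw [e]
    exact hC M n n' j hn hn' hne hnM hn'M hj1 hj2

end Summit.Parity.GeneralizedHardyLittlewood.Theorems.CosetDecorrelation.GramSplitFareyPhase
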